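import Summits.BirchSwinnertonDyer.BirchSwinnertonDyer.Theorems.UniversalToricDescentTwinSplitIMCAtThreeGoodSSUnitTier
import Summits.BirchSwinnertonDyer.BirchSwinnertonDyer.Theorems.UniversalToricDescentTwinSplitIMCAtThreeMultUnitTierFlat
import Literature.NumberTheory.EllipticCurves.KolyvaginShaIndexBound
import Literature.NumberTheory.EllipticCurves.Jetchev2008.HeegnerIndexTamagawaBound
import Literature.NumberTheory.EllipticCurves.ComplexMultiplicationBurungaleFlachPrimaryProofs
import HarnessLib

/-!
# Route `UniversalToricDescent`, crux #3 children 20695 (C) / 20694 (B): the PRIMITIVE-PAIR tier `P ⊋ U`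
# — utd-idea g7's sketch `Sketch-utd-idea-g7.lean` (sha16 9f3ca323704a8e21, rc 0, 0 sorry) LANDED VERBATIM as a
# Theorems helper by the line lead bsd-wall-utd-p2 g4 (TURNKEY-2 of bsd-wall INBOX 20:29:56Z / 20:34:43Z; namespace
# moved from `Cruxes.…` to `Theorems.UniversalToricDescentTwinSplit.PrimitivePair`; `--supports stmt-BirchSwinnertonDyer-20695 --as helper`)

THEOREMS ONLY (no definition, no named fact minted, no `sorry`); every named input is an explicit hypothesis
(`kolyvagin`, `Kolyvagin1990_padicValNat_card_sha_le`, `thm331…`, `thm513…`, LZZ18, Hsieh14 Thm A, Jetchev 2008 Cor. 1.5,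
and in §1/§5 the OPEN CÇSS18 claim `hC`), so each theorem is a CONDITIONAL instance-level result; nothing here closes
20695/20694 (∀-statements) and BSD is not proved by any of this. Census numbers (utd-idea g7): tier P re-keys C 401→471/603
and B 295→343/675 classes with a qualifying pair of record. Original sketch header follows.


Crux idea `primitive-pair-tier` on `TwinSplitIMCAtThreeGoodSS` (stmt-20695, bucket C) and
`TwinSplitIMCAtThreeMult` (stmt-20694, bucket B).  LEVER: Kolyvagin's EXACT finite-level theorem at the
twin `(E′, K)` — tree fact `Kolyvagin1990_padicValNat_card_sha_le` (`ord_p #Ш(E/K) ≤ 2·ord_p [E(K):ℤy_K]`,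
p odd, `ρ̄_{E,p}` onto, NO `p ∤ N` clause: McCallum 1991 §1 / Gross 1991 Prop. 2.1) + `kolyvagin`
(rank one and `Ш` finite) — discharges, at every pair with `3 ∤ [E′(K):ℤP]`, ALL the arithmetic
hypotheses `hrk`, `hfin`, `hSha` of the unit tier (p555429 / p554486) and the index identity `hIdx` of the
rank-one value route (p550002 / p553371) when moreover `3 ∤ ∏ c_w`, `3 ∤ c_Manin`: no BSD₃ of the twin
pair, no `Ш_an = #Ш` identification, no GZK input typed by hand.  Everything below is sorry-free.
-/

noncomputable section

open scoped Classical Topology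

set_option linter.dupNamespace false
set_option autoImplicit false

namespace Summit.BirchSwinnertonDyer.BirchSwinnertonDyer.Theorems.UniversalToricDescentTwinSplit.PrimitivePair

open Filter PowerSeries WeierstrassCurve NumberField IsDedekindDomain Field
  Literature.NumberTheory.EllipticCurves
  Literature.NumberTheory.EllipticCurves.ModularForms
  Literature.NumberTheory.EllipticCurves.Rank1Residual
  Literature.NumberTheory.EllipticCurves.JetchevSkinnerWan2017
  Literature.NumberTheory.EllipticCurves.CastellaGrossiLeeSkinner2022
  Literature.NumberTheory.GaloisRepresentations
  Literature.NumberTheory.GaloisCohomology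
  Summit.BirchSwinnertonDyer.Rank1Residual
  Summit.BirchSwinnertonDyer.Rank1Residual.X11b
  Summit.BirchSwinnertonDyer.Rank1Residual.X11b.Halves
  Summit.BirchSwinnertonDyer.Rank1Residual.X11b.CongruenceLimit
  Summit.BirchSwinnertonDyer.BirchSwinnertonDyer.Theorems.SchneiderFree
  Summit.BirchSwinnertonDyer.BirchSwinnertonDyer.Theorems.UniversalToricDescentTwinSplit

/-! ## §0 The lever: Kolyvagin's exact theorem discharges rank, finiteness and the `p`-part of `Ш` -/

/-- **FIRST LEMMA of the line (proved).** `E/ℚ` of conductor `N`, `K` imaginary quadratic Heegner for `N`,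
`P ∈ E(K)` a Heegner point of infinite order, `p` an odd prime with `ρ̄_{E,p}` onto and `p ∤ [E(K):ℤP]`.
Then `rank E(K) = 1`, `Ш(E/K)[p^∞]` is finite and TRIVIAL.  Inputs: the tree facts `kolyvagin`
(Kolyvagin 1990) and `Kolyvagin1990_padicValNat_card_sha_le` (Kolyvagin 1990 / McCallum 1991 §1 — valid at
`p ∣ N`, in particular at a multiplicative or supersingular `p = 3`). -/
theorem rank_finite_card_primaryComponent_of_kolyvagin_of_not_dvd_index
    {N : ℕ} [NeZero N] {W : WeierstrassCurve ℚ} [W.IsElliptic] {K : Type} [Field K] [NumberField K]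
    (hKo : kolyvagin N W K) (hB : Kolyvagin1990_padicValNat_card_sha_le N W K)
    {p : ℕ} [Fact p.Prime] (hp2 : p ≠ 2) (hρ : W.HasSurjectiveModNGaloisRep p)
    (hK : IsImaginaryQuadratic K) (hH : SatisfiesHeegnerHypothesis N K)
    {P : (W.baseChange K).toAffine.Point} (hP : IsHeegnerPoint N W K P) (hnt : ¬ IsOfFinAddOrder P)
    (hI : ¬ p ∣ (AddSubgroup.zmultiples P).index) :
    (W.baseChange K).mordellWeilRank = 1 ∧
      Finite (AddCommGroup.primaryComponent (W.baseChange K).sha p) ∧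
      Nat.card (AddCommGroup.primaryComponent (W.baseChange K).sha p) = 1 := by
  have hp : p.Prime := Fact.out
  obtain ⟨hrk, hfin⟩ := hKo hK hH hP hnt
  haveI : Finite (W.baseChange K).sha := hfin
  have hfinp : Finite (AddCommGroup.primaryComponent (W.baseChange K).sha p) := inferInstance
  have h0 : padicValNat p (Nat.card (W.baseChange K).sha) = 0 :=
    padicValNat_card_sha_eq_zero_of_not_dvd_index hB hK hH hP hnt hp hp2 hρ hI
  obtain ⟨m, hm, hpm⟩ := exists_natCard_eq_card_primaryComponent_mul (A := (W.baseChange K).sha) p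
  obtain ⟨k, hk⟩ := exists_natCard_primaryComponent_eq_pow (A := (W.baseChange K).sha) p
  refine ⟨hrk, hfinp, ?_⟩
  have hm0 : m ≠ 0 := fun h ↦ hpm (h ▸ dvd_zero p)
  have hk0 : k = 0 := by
    rw [hm, hk, padicValNat.mul (pow_ne_zero _ hp.ne_zero) hm0, padicValNat.prime_pow,
      padicValNat.eq_zero_of_not_dvd hpm, add_zero] at h0
    exact h0
  rw [hk, hk0, pow_zero]

section Three

variable (W' : WeierstrassCurve ℚ) [W'.IsElliptic] [W'.IsGloballyMinimal] (N' : ℕ) [NeZero N']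
  (K : Type) [Field K] [NumberField K] (Dt' : ModularParametrizationData W' N')
  (κ : ZpExtension K 3) (γ : absoluteGaloisGroup K)
  (𝔭 𝔭' : HeightOneSpectrum (𝓞 K)) (ι' : PadicAlgCl 3 ≃+* ℂ)

/-! ## §1 Bucket C (good supersingular), tier `P`: crux #3 (ii) at the instance from PRE + print + Kolyvagin -/

/-- **Tier P, bucket C.** Child 20695's conjuncts (i) ∧ (ii) at a rank-one instance `(W′, N′, K, Dt′, κ, γ,
𝔭, 𝔭′, ι′)` with `3 ∤ [E′(K):ℤP]`, `3 ∤ ∏_w c_w(E′/K)`, `3 ∤ c_Manin`, from: the PRE claim `hC` (CÇSS18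
Thm 5.7 + Lemma 5.5: the Howard frame), JSW17 Thm 3.3.1, CGLS22 Thm 5.1.3, and Kolyvagin 1990 (`hKo`, `hB`).
Compared with `twinSplit_instance_of_goodSS_of_ccss_of_thm331_of_thm513` (p550002) the hypotheses `hrk`,
`hfin`, `hIdx` (= BSD₃ of the twin pair in index form) are GONE. -/
theorem twinSplit_instance_of_goodSS_of_primitivePair_of_ccss_of_print_of_kolyvagin
    (hC : CastellaCiperianiSkinnerSprung2018.thm57_lemma55_exists_isBDPLFunction_isTorsion_mem_charIdeal_OPEN)
    (h331 : thm331_anticyclotomicControl) (h513 : thm513_exists_isBDPLFunction_valueAtOne_disc)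
    (hKo : kolyvagin N' W' K) (hB : Kolyvagin1990_padicValNat_card_sha_le N' W' K)
    (hss : GoodSS W' 3) (hsurj : W'.HasSurjectiveModNGaloisRep 3) (hN' : W'.conductorNorm ℤ = N')
    (hcM : ¬ (3 : ℤ) ∣ Dt'.c)
    (hK : IsImaginaryQuadratic K) (hH : SatisfiesHeegnerHypothesis N' K)
    (hodd : Odd (NumberField.discr K)) (hκ : κ.IsAnticyclotomic) [hγ : Fact (κ.IsTopGenerator γ)]
    (h𝔭 : ((3 : ℕ) : 𝓞 K) ∈ 𝔭.asIdeal)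
    (he : 𝔭.asIdeal.ramificationIdx (𝓞 ℚ) = 1) (hf : 𝔭.asIdeal.inertiaDeg (𝓞 ℚ) = 1)
    (h𝔭' : ((3 : ℕ) : 𝓞 K) ∈ 𝔭'.asIdeal) (hne : 𝔭' ≠ 𝔭)
    (hι' : BranchInducesPrime 3 ι' 𝔭)
    (H : HeegnerDatum N' (NumberField.discr K)) (w : InfinitePlace K)
    (P : (W'.baseChange K).toAffine.Point)
    (hPH : WeierstrassCurve.Affine.Point.map w.embedding.toRatAlgHom P = heegnerPointComplex Dt' H)
    (hP0 : ¬ IsOfFinAddOrder P)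
    (hTam : ¬ 3 ∣ (W'.baseChange K).tamagawaProduct)
    (hInd : ¬ 3 ∣ (AddSubgroup.zmultiples P).index) :
    (∃ (ΩK : ℂ) (Ωp : ℂ_[3]) (L' : UnrSeries 3), ΩK ≠ 0 ∧ Ωp ≠ 0 ∧
        IsBDPLFunction ι' 𝔭 κ γ Dt'.f ΩK Ωp L') ∧
      (∀ (ΩK : ℂ) (Ωp : ℂ_[3]) (L' : UnrSeries 3), ΩK ≠ 0 → Ωp ≠ 0 →
        IsBDPLFunction ι' 𝔭 κ γ Dt'.f ΩK Ωp L' →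
        (AcSelmer.XAc.charIdeal (W'.baseChange K) 3 κ 𝔭' ∅ γ).map (PowerSeries.map (toUnr 3)) =
          Ideal.span {L'}) := by
  haveI : Fact (Nat.Prime 3) := ⟨Nat.prime_three⟩
  obtain ⟨hrk, hfin, hcard⟩ := rank_finite_card_primaryComponent_of_kolyvagin_of_not_dvd_index hKo hB
    (by decide) hsurj hK hH ⟨Dt', H, w.embedding, hPH⟩ hP0 hInd
  have hc : Dt'.c ≠ 0 := fun h ↦ hcM (h ▸ dvd_zero 3)
  have hIdx : 2 * (padicValNat 3 (AddSubgroup.zmultiples P).index : ℤ) =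
      (padicValNat 3 (Nat.card (AddCommGroup.primaryComponent (W'.baseChange K).sha 3)) : ℤ) +
        (padicValNat 3 (W'.baseChange K).tamagawaProduct : ℤ) + 2 * padicValInt 3 Dt'.c := by
    rw [hcard, padicValNat.eq_zero_of_not_dvd hInd, padicValNat.eq_zero_of_not_dvd hTam,
      padicValInt.eq_zero_of_not_dvd hcM]
    simp
  exact twinSplit_instance_of_goodSS_of_ccss_of_thm331_of_thm513 W' N' K Dt' κ γ 𝔭 𝔭' ι' hC h331 h513
    hss hsurj hN' hc hK hH hodd hκ h𝔭 he hf h𝔭' hne hι' H w P hPH hP0 hrk hfin hIdx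

/-! ## §2 Bucket C, tier `U ⊂ P`: crux #3 at the instance from REFEREED PRINT + Kolyvagin + three census flags -/

/-- **Tier U, bucket C, de-conditionalised.** p555429's `twinSplit_instance_of_goodSS_of_unitPair_of_thm331_of_thm513`
with its arithmetic hypotheses `hrk`, `hfin`, `hSha` (GZK for the twin pair + `3 ∤ #Ш(E′/K)[3^∞]`) REPLACED by
Kolyvagin 1990 (`hKo`, `hB`): what remains is refereed print (`h331`, `h513`), the instance data, and the three
computable flags `3 ∤ ∏ c_w`, `3 ∤ [E′(K):ℤP]`, `ord₃ log_ω P = 1`. -/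
theorem twinSplit_instance_of_goodSS_of_unitPair_of_print_of_kolyvagin
    (h331 : thm331_anticyclotomicControl) (h513 : thm513_exists_isBDPLFunction_valueAtOne_disc)
    (hKo : kolyvagin N' W' K) (hB : Kolyvagin1990_padicValNat_card_sha_le N' W' K)
    (hss : GoodSS W' 3) (hsurj : W'.HasSurjectiveModNGaloisRep 3) (hN' : W'.conductorNorm ℤ = N')
    (hcM : ¬ (3 : ℤ) ∣ Dt'.c)
    (hK : IsImaginaryQuadratic K) (hH : SatisfiesHeegnerHypothesis N' K)
    (hodd : Odd (NumberField.discr K)) (hκ : κ.IsAnticyclotomic) [hγ : Fact (κ.IsTopGenerator γ)]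
    (h𝔭 : ((3 : ℕ) : 𝓞 K) ∈ 𝔭.asIdeal)
    (he : 𝔭.asIdeal.ramificationIdx (𝓞 ℚ) = 1) (hf : 𝔭.asIdeal.inertiaDeg (𝓞 ℚ) = 1)
    (h𝔭' : ((3 : ℕ) : 𝓞 K) ∈ 𝔭'.asIdeal)
    (hι' : BranchInducesPrime 3 ι' 𝔭)
    (H : HeegnerDatum N' (NumberField.discr K)) (w : InfinitePlace K)
    (P : (W'.baseChange K).toAffine.Point)
    (hPH : WeierstrassCurve.Affine.Point.map w.embedding.toRatAlgHom P = heegnerPointComplex Dt' H)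
    (hP0 : ¬ IsOfFinAddOrder P)
    (hTam : ¬ 3 ∣ (W'.baseChange K).tamagawaProduct)
    (hInd : ¬ 3 ∣ (AddSubgroup.zmultiples P).index)
    (hlog : ‖Castella2018.padicLogOmega W' 3 (embAt K 3 𝔭 h𝔭 he hf) P‖ = (3 : ℝ)⁻¹) :
    (∃ (ΩK : ℂ) (Ωp : ℂ_[3]) (L' : UnrSeries 3), ΩK ≠ 0 ∧ Ωp ≠ 0 ∧
        IsBDPLFunction ι' 𝔭 κ γ Dt'.f ΩK Ωp L') ∧
      (∀ (ΩK : ℂ) (Ωp : ℂ_[3]) (L' : UnrSeries 3), ΩK ≠ 0 → Ωp ≠ 0 →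
        IsBDPLFunction ι' 𝔭 κ γ Dt'.f ΩK Ωp L' →
        (AcSelmer.XAc.charIdeal (W'.baseChange K) 3 κ 𝔭' ∅ γ).map (PowerSeries.map (toUnr 3)) =
          Ideal.span {L'}) := by
  haveI : Fact (Nat.Prime 3) := ⟨Nat.prime_three⟩
  obtain ⟨hrk, hfin, hcard⟩ := rank_finite_card_primaryComponent_of_kolyvagin_of_not_dvd_index hKo hB
    (by decide) hsurj hK hH ⟨Dt', H, w.embedding, hPH⟩ hP0 hInd
  have hSha : ¬ 3 ∣ Nat.card (AddCommGroup.primaryComponent (W'.baseChange K).sha 3) := by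
    rw [hcard]; decide
  exact twinSplit_instance_of_goodSS_of_unitPair_of_thm331_of_thm513 W' N' K Dt' κ γ 𝔭 𝔭' ι' h331 h513
    hss hsurj hN' hcM hK hH hodd hκ h𝔭 he hf h𝔭' hι' H w P hPH hP0 hrk hfin hSha hTam hInd hlog

/-! ## §3 Bucket B (multiplicative), tier `P`: crux #3 at the instance from ONE Howard frame + print + Kolyvagin -/

/-- **Tier P, bucket B.** p553371's `twinSplit_instance_of_mult_of_howardFrame_of_thm331mult_of_lzz` with
`hrk`, `hfin`, `hIdx` REPLACED by Kolyvagin 1990 (`hKo`, `hB`; `3 ∥ N′` is allowed by McCallum §1 / Gross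
Prop. 2.1) and the two flags `3 ∤ ∏_{w split} c_w`, `3 ∤ [E′(K):ℤP]`.  The Howard frame `hHow` (a research
statement at a multiplicative `3`) stays. -/
theorem twinSplit_instance_of_mult_of_primitivePair_of_howardFrame_of_print_of_kolyvagin
    (h331 : thm331_anticyclotomicControl_mult) (hF : LiuZhangZhang2018.thm151_thm153_modularCurve_heegnerVector)
    (hKo : kolyvagin N' W' K) (hB : Kolyvagin1990_padicValNat_card_sha_le N' W' K)
    (hmult : Mult W' 3) (hsurj : W'.HasSurjectiveModNGaloisRep 3) (hN' : W'.conductorNorm ℤ = N')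
    (hcM : ¬ (3 : ℤ) ∣ Dt'.c)
    (hK : IsImaginaryQuadratic K) (hH : SatisfiesHeegnerHypothesis N' K) (hodd : Odd (NumberField.discr K))
    (hκ : κ.IsAnticyclotomic) [hγ : Fact (κ.IsTopGenerator γ)]
    (h𝔭 : ((3 : ℕ) : 𝓞 K) ∈ 𝔭.asIdeal) (he : 𝔭.asIdeal.ramificationIdx (𝓞 ℚ) = 1)
    (hf : 𝔭.asIdeal.inertiaDeg (𝓞 ℚ) = 1) (h𝔭' : ((3 : ℕ) : 𝓞 K) ∈ 𝔭'.asIdeal)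
    (hι' : BranchInducesPrime 3 ι' 𝔭)
    (H : HeegnerDatum N' (NumberField.discr K)) (ιK : K →+* ℂ) (P : (W'.baseChange K).toAffine.Point)
    (hPH : WeierstrassCurve.Affine.Point.map ιK.toRatAlgHom P = heegnerPointComplex Dt' H)
    (hP0 : ¬ IsOfFinAddOrder P)
    (hTam : ¬ 3 ∣ splitTamagawaProduct W' K)
    (hInd : ¬ 3 ∣ (AddSubgroup.zmultiples P).index)
    (hHow : ∃ (ΩK : ℂ) (Ωp : ℂ_[3]) (L : UnrSeries 3), ΩK ≠ 0 ∧ Ωp ≠ 0 ∧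
      IsBDPLFunction ι' 𝔭 κ γ Dt'.f ΩK Ωp L ∧
      L ∈ (AcSelmer.XAc.charIdeal (W'.baseChange K) 3 κ 𝔭' ∅ γ).map (PowerSeries.map (toUnr 3))) :
    (∃ (ΩK : ℂ) (Ωp : ℂ_[3]) (L' : UnrSeries 3), ΩK ≠ 0 ∧ Ωp ≠ 0 ∧
        IsBDPLFunction ι' 𝔭 κ γ Dt'.f ΩK Ωp L') ∧
      (∀ (ΩK : ℂ) (Ωp : ℂ_[3]) (L' : UnrSeries 3), ΩK ≠ 0 → Ωp ≠ 0 →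
        IsBDPLFunction ι' 𝔭 κ γ Dt'.f ΩK Ωp L' →
        (AcSelmer.XAc.charIdeal (W'.baseChange K) 3 κ 𝔭' ∅ γ).map (PowerSeries.map (toUnr 3)) =
          Ideal.span {L'}) := by
  haveI : Fact (Nat.Prime 3) := ⟨Nat.prime_three⟩
  obtain ⟨hrk, hfin, hcard⟩ := rank_finite_card_primaryComponent_of_kolyvagin_of_not_dvd_index hKo hB
    (by decide) hsurj hK hH ⟨Dt', H, ιK, hPH⟩ hP0 hInd
  have hIdx : 2 * (padicValNat 3 (AddSubgroup.zmultiples P).index : ℤ) =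
      (padicValNat 3 (Nat.card (AddCommGroup.primaryComponent (W'.baseChange K).sha 3)) : ℤ) +
        (padicValNat 3 (splitTamagawaProduct W' K) : ℤ) := by
    rw [hcard, padicValNat.eq_zero_of_not_dvd hInd, padicValNat.eq_zero_of_not_dvd hTam]
    simp
  exact twinSplit_instance_of_mult_of_howardFrame_of_thm331mult_of_lzz W' N' K Dt' κ γ 𝔭 𝔭' ι' h331 hF
    hmult hsurj hN' hcM hK hH hodd hκ h𝔭 he hf h𝔭' hι' H ιK P hPH hP0 hrk hfin hIdx hHow

/-! ## §4 Bucket B, tier `U ⊂ P` in ♭-currency: crux #3♭ at the instance from REFEREED PRINT + Kolyvagin + flags -/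

/-- **Tier U♭, bucket B, de-conditionalised.** p554486's `twinSplitFlat_instance_of_mult_of_unitPair_of_print`
(Hsieh 2014 Thm A at any level, LZZ18, JSW17-mult; ♭ = `𝓞_ℂ₃`-integral frames) with `hrk`, `hfin`, `hSha`
REPLACED by Kolyvagin 1990 (`hKo`, `hB`): refereed print + the three flags only. -/
theorem twinSplitFlat_instance_of_mult_of_unitPair_of_print_of_kolyvagin
    (hA : Hsieh2014.thmA_exists_isHsiehLFunction_unrPeriod_anyLevel)
    (hF : LiuZhangZhang2018.thm151_thm153_modularCurve_heegnerVector) (h331 : thm331_anticyclotomicControl_mult)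
    (hKo : kolyvagin N' W' K) (hB : Kolyvagin1990_padicValNat_card_sha_le N' W' K)
    (hmult : Mult W' 3) (hsurj : W'.HasSurjectiveModNGaloisRep 3) (hN' : W'.conductorNorm ℤ = N')
    (hcM : ¬ (3 : ℤ) ∣ Dt'.c)
    (hK : IsImaginaryQuadratic K) (hH : SatisfiesHeegnerHypothesis N' K) (hodd : Odd (NumberField.discr K))
    (hκ : κ.IsAnticyclotomic) [hγ : Fact (κ.IsTopGenerator γ)]
    (h𝔭 : ((3 : ℕ) : 𝓞 K) ∈ 𝔭.asIdeal) (he : 𝔭.asIdeal.ramificationIdx (𝓞 ℚ) = 1)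
    (hf : 𝔭.asIdeal.inertiaDeg (𝓞 ℚ) = 1) (h𝔭' : ((3 : ℕ) : 𝓞 K) ∈ 𝔭'.asIdeal)
    (hι' : BranchInducesPrime 3 ι' 𝔭)
    (H : HeegnerDatum N' (NumberField.discr K)) (ιK : K →+* ℂ) (P : (W'.baseChange K).toAffine.Point)
    (hPH : WeierstrassCurve.Affine.Point.map ιK.toRatAlgHom P = heegnerPointComplex Dt' H)
    (hP0 : ¬ IsOfFinAddOrder P)
    (hTam : ¬ 3 ∣ splitTamagawaProduct W' K) (hInd : ¬ 3 ∣ (AddSubgroup.zmultiples P).index)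
    (hlog : ‖logOmega W' 3 (embAt K 3 𝔭 h𝔭 he hf) P‖ = (3 : ℝ)⁻¹) :
    (∃ (ΩK : ℂ) (Ωp : ℂ_[3]) (Q' : PowerSeries 𝓞_ℂ_[3]), ΩK ≠ 0 ∧ Ωp ≠ 0 ∧
        R1.IsBDPLFunctionInt 3 ι' 𝔭 κ γ Dt'.f ΩK Ωp Q') ∧
      (∀ (ΩK : ℂ) (Ωp : ℂ_[3]) (Q' : PowerSeries 𝓞_ℂ_[3]), ΩK ≠ 0 → Ωp ≠ 0 →
        R1.IsBDPLFunctionInt 3 ι' 𝔭 κ γ Dt'.f ΩK Ωp Q' →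
        (AcSelmer.XAc.charIdeal (W'.baseChange K) 3 κ 𝔭' ∅ γ).map (PowerSeries.map (R1.toCpInt 3)) =
          Ideal.span {Q'}) := by
  haveI : Fact (Nat.Prime 3) := ⟨Nat.prime_three⟩
  obtain ⟨hrk, hfin, hcard⟩ := rank_finite_card_primaryComponent_of_kolyvagin_of_not_dvd_index hKo hB
    (by decide) hsurj hK hH ⟨Dt', H, ιK, hPH⟩ hP0 hInd
  have hSha : ¬ 3 ∣ Nat.card (AddCommGroup.primaryComponent (W'.baseChange K).sha 3) := by
    rw [hcard]; decide
  exact twinSplitFlat_instance_of_mult_of_unitPair_of_print W' N' K Dt' κ γ 𝔭 𝔭' ι' hA hF h331 hmult hsurj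
    hN' hcM hK hH hodd hκ h𝔭 he hf h𝔭' hι' H ιK P hPH hP0 hrk hfin hSha hTam hInd hlog

/-! ## §5 Bucket C, tier `P_J ⊋ P` (ONE Tamagawa-3 carrier): Jetchev 2008 in place of Kolyvagin's exact bound -/

/-- **Tier P_J, bucket C.** Same instance data as §1; the index flag is now `ord₃[E′(K):ℤP] = ord₃ c_{q₀}(E′)`
for ONE prime `q₀ ∣ N′` carrying the whole `3`-part of the `K`-Tamagawa product
(`ord₃ ∏_w c_w(E′/K) = 2·ord₃ c_{q₀}`), plus Jetchev's optimality clause `hopt`.  Jetchev 2008 Cor. 1.5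
(`ord₃ #Ш(E′/K)[3^∞] + 2 ord₃ c_{q₀} ≤ 2 ord₃ [E′(K):ℤP]`, Hypothesis (∗): `3 ∤ N′` — bucket C only — and
`ρ̄₃` onto) forces `#Ш(E′/K)[3^∞]` prime to `3`, and `hIdx` reads `2m = 0 + 2m + 0`.  Inputs: PRE claim `hC`,
JSW17 3.3.1, CGLS22 5.1.3, Kolyvagin (`hKo`: rank one, `Ш` finite), Jetchev (`hJ`). -/
theorem twinSplit_instance_of_goodSS_of_singleCarrier_of_ccss_of_print_of_jetchev
    (hC : CastellaCiperianiSkinnerSprung2018.thm57_lemma55_exists_isBDPLFunction_isTorsion_mem_charIdeal_OPEN)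
    (h331 : thm331_anticyclotomicControl) (h513 : thm513_exists_isBDPLFunction_valueAtOne_disc)
    (hKo : kolyvagin N' W' K) (hJ : Jetchev2008.cor15_padicValNat_card_primaryComponent_sha_le)
    (hss : GoodSS W' 3) (hsurj : W'.HasSurjectiveModNGaloisRep 3) (hN' : W'.conductorNorm ℤ = N')
    (hcM : ¬ (3 : ℤ) ∣ Dt'.c)
    (hK : IsImaginaryQuadratic K) (hH : SatisfiesHeegnerHypothesis N' K)
    (hodd : Odd (NumberField.discr K)) (hκ : κ.IsAnticyclotomic) [hγ : Fact (κ.IsTopGenerator γ)]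
    (h𝔭 : ((3 : ℕ) : 𝓞 K) ∈ 𝔭.asIdeal)
    (he : 𝔭.asIdeal.ramificationIdx (𝓞 ℚ) = 1) (hf : 𝔭.asIdeal.inertiaDeg (𝓞 ℚ) = 1)
    (h𝔭' : ((3 : ℕ) : 𝓞 K) ∈ 𝔭'.asIdeal) (hne : 𝔭' ≠ 𝔭)
    (hι' : BranchInducesPrime 3 ι' 𝔭)
    (H : HeegnerDatum N' (NumberField.discr K)) (w : InfinitePlace K)
    (P : (W'.baseChange K).toAffine.Point)
    (hPH : WeierstrassCurve.Affine.Point.map w.embedding.toRatAlgHom P = heegnerPointComplex Dt' H)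
    (hP0 : ¬ IsOfFinAddOrder P)
    (hopt : ∃ Dt : ModularParametrizationData W' N',
      ∀ z ∈ Dt.L.lattice, ∃ w ∈ periodLattice Dt.f, z = (Dt.c : ℂ) * w)
    (q₀ : ℕ) [Fact q₀.Prime] (hq₀ : q₀ ∣ N')
    (hcar : padicValNat 3 (W'.baseChange K).tamagawaProduct =
      2 * padicValNat 3 ((W'.baseChange ℚ_[q₀]).localTamagawaNumber ℤ_[q₀]))
    (hIq : padicValNat 3 (AddSubgroup.zmultiples P).index =
      padicValNat 3 ((W'.baseChange ℚ_[q₀]).localTamagawaNumber ℤ_[q₀])) :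
    (∃ (ΩK : ℂ) (Ωp : ℂ_[3]) (L' : UnrSeries 3), ΩK ≠ 0 ∧ Ωp ≠ 0 ∧
        IsBDPLFunction ι' 𝔭 κ γ Dt'.f ΩK Ωp L') ∧
      (∀ (ΩK : ℂ) (Ωp : ℂ_[3]) (L' : UnrSeries 3), ΩK ≠ 0 → Ωp ≠ 0 →
        IsBDPLFunction ι' 𝔭 κ γ Dt'.f ΩK Ωp L' →
        (AcSelmer.XAc.charIdeal (W'.baseChange K) 3 κ 𝔭' ∅ γ).map (PowerSeries.map (toUnr 3)) =
          Ideal.span {L'}) := by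
  haveI : Fact (Nat.Prime 3) := ⟨Nat.prime_three⟩
  have hP : IsHeegnerPoint N' W' K P := ⟨Dt', H, w.embedding, hPH⟩
  obtain ⟨hrk, hfinSha⟩ := hKo hK hH hP hP0
  haveI : Finite (W'.baseChange K).sha := hfinSha
  have hfin : Finite (AddCommGroup.primaryComponent (W'.baseChange K).sha 3) := inferInstance
  have h3N : ¬ 3 ∣ N' := by
    rw [← hN']
    intro h
    exact ((W'.dvd_conductorNorm_iff_not_hasGoodReductionAtPrime 3).mp h) hss.1
  have hd3 : NumberField.discr K ≠ -3 := discr_ne_neg_three_of_degreeOne hK h𝔭 he hf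
  have hJq := hJ N' W' K hK hd3 hH hopt hP hP0 3 (by decide) h3N hsurj q₀ hq₀
  have hSha0 : padicValNat 3 (Nat.card (AddCommGroup.primaryComponent (W'.baseChange K).sha 3)) = 0 := by
    rw [hIq] at hJq
    omega
  have hc : Dt'.c ≠ 0 := fun h ↦ hcM (h ▸ dvd_zero 3)
  have hIdx : 2 * (padicValNat 3 (AddSubgroup.zmultiples P).index : ℤ) =
      (padicValNat 3 (Nat.card (AddCommGroup.primaryComponent (W'.baseChange K).sha 3)) : ℤ) +
        (padicValNat 3 (W'.baseChange K).tamagawaProduct : ℤ) + 2 * padicValInt 3 Dt'.c := by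
    rw [hSha0, hcar, hIq, padicValInt.eq_zero_of_not_dvd hcM]
    push_cast
    ring
  exact twinSplit_instance_of_goodSS_of_ccss_of_thm331_of_thm513 W' N' K Dt' κ γ 𝔭 𝔭' ι' hC h331 h513
    hss hsurj hN' hc hK hH hodd hκ h𝔭 he hf h𝔭' hne hι' H w P hPH hP0 hrk hfin hIdx

end Three

end Summit.BirchSwinnertonDyer.BirchSwinnertonDyer.Theorems.UniversalToricDescentTwinSplit.PrimitivePair

end
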